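import Summits.QuantumFields.YangMills.Theorems.ToronValleyVolumeZeroModeScaling

/-!
# Zero-mode quartic of the toron valley, IV: the β-free kernel `κ`, its truncations `λ_M ↑ κ`, and `K = ∫κ ∈ (0,∞)`

`κ(y) = 𝟙{|y_μ,2| ≤ 1 ∀μ}·exp(−Σ_μ plSq(y_μ) − ½Σ_{μ,ν} cr(y_μ,y_ν))` is the exact image of the dominating integrand under the
anisotropic rescaling; `λ_M` adds the ball constraint `plSq(y_μ) ≤ (M+1)²` and the quartic correction `plSum²/(2(M+1)⁴)`.
Monotone convergence gives `⨆_M ∫λ_M = ∫κ = K`; `K < ∞` by Gaussian domination and `K > 0` from the product of unit balls.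

HONEST LABEL: helper analysis for a plan-only BC5 rung (`stub_rung_zeroModeLog4`) of crux ⟨stmt-QuantumFields-24497⟩ on a
DRAFT-by-design sub-route (`ToronValleyVolume`, LINE g15-B of ym-idea-4); it is NOT in the crux composition; no crux, rung of the
ladder, leaf or summit statement is proved here; the Yang–Mills mass gap is NOT proved by this.
-/

noncomputable section

namespace Summit.QuantumFields.YangMills.Theorems.ToronValleyVolume.ZeroMode

open MeasureTheory Real Finset Set
open scoped ENNReal
open Summit.QuantumFields.YangMills.Cruxes.ToronTubeVolumeLaw.Birth

/-! ## §8 The β-free kernel `κ`, its truncations `λ_M`, and `K = ∫κ ∈ (0, ∞)` -/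

/-- Planar sum `Σ_μ plSq(x_μ)`. -/
def plSum (x : Fin 3 → EuclideanSpace ℝ (Fin 3)) : ℝ := ∑ μ, plSq (x μ)

/-- Cross sum `½ Σ_μ Σ_ν cr(x_μ, x_ν)`. -/
def crSum (x : Fin 3 → EuclideanSpace ℝ (Fin 3)) : ℝ := (1 / 2) * ∑ μ, ∑ ν, cr (x μ) (x ν)

/-- `plSum ≥ 0`. -/
theorem plSum_nonneg (x : Fin 3 → EuclideanSpace ℝ (Fin 3)) : 0 ≤ plSum x :=
  Finset.sum_nonneg fun _ _ => plSq_nonneg _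

/-- `crSum ≥ 0`. -/
theorem crSum_nonneg (x : Fin 3 → EuclideanSpace ℝ (Fin 3)) : 0 ≤ crSum x :=
  mul_nonneg (by norm_num) (Finset.sum_nonneg fun μ _ => Finset.sum_nonneg fun ν _ => cr_nonneg _ _)

/-- `crSum ≤ Q₃` (Lagrange identity, termwise). -/
theorem crSum_le_quartic (x : Fin 3 → EuclideanSpace ℝ (Fin 3)) : crSum x ≤ zeroModeQuartic 3 x := by
  rw [quartic_eq_half_sum]; unfold crSum
  exact mul_le_mul_of_nonneg_left
    (Finset.sum_le_sum fun μ _ => Finset.sum_le_sum fun ν _ => cr_le_pd _ _) (by norm_num)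

/-- `Q₃ ≤ ½ plSum² + crSum` (planar Cauchy–Schwarz, termwise; diagonal terms over-counted). -/
theorem quartic_le_plSum_sq_add_crSum (x : Fin 3 → EuclideanSpace ℝ (Fin 3)) :
    zeroModeQuartic 3 x ≤ (1 / 2) * plSum x ^ 2 + crSum x := by
  rw [quartic_eq_half_sum]; unfold crSum plSum
  rw [sq, Finset.sum_mul_sum, ← mul_add, ← Finset.sum_add_distrib]
  refine mul_le_mul_of_nonneg_left ?_ (by norm_num)
  refine Finset.sum_le_sum fun μ _ => ?_
  rw [← Finset.sum_add_distrib]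
  exact Finset.sum_le_sum fun ν _ => pd_le_plSq_mul_add_cr _ _

/-- `Σ_μ D(x_μ, r e₃) = r² · plSum(x)`. -/
theorem sum_pd_smul_e3 (x : Fin 3 → EuclideanSpace ℝ (Fin 3)) (r : ℝ) :
    ∑ μ, pd (x μ) (r • e3) = r ^ 2 * plSum x := by
  unfold plSum; rw [Finset.mul_sum]; exact Finset.sum_congr rfl fun μ _ => pd_smul_e3 _ _

/-- Scaling: `plSum(Λ x) = s² plSum(x)`. -/
theorem plSum_Lam (s t : ℝ) (x : Fin 3 → EuclideanSpace ℝ (Fin 3)) : plSum (Lam s t x) = s ^ 2 * plSum x := by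
  unfold plSum; rw [Finset.mul_sum]; exact Finset.sum_congr rfl fun μ _ => by rw [Lam_apply, plSq_diag3]

/-- Scaling: `crSum(Λ x) = s²t² crSum(x)`. -/
theorem crSum_Lam (s t : ℝ) (x : Fin 3 → EuclideanSpace ℝ (Fin 3)) :
    crSum (Lam s t x) = s ^ 2 * t ^ 2 * crSum x := by
  unfold crSum
  simp_rw [Lam_apply, cr_diag3, ← Finset.mul_sum]
  ring

/-- The slab `|x_μ,2| ≤ 1` for all three columns. -/
def slab : Set (Fin 3 → EuclideanSpace ℝ (Fin 3)) := {x | ∀ μ, |x μ 2| ≤ 1}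

/-- The truncated slab: additionally `plSq(x_μ) ≤ (M+1)²`. -/
def slabBall (M : ℕ) : Set (Fin 3 → EuclideanSpace ℝ (Fin 3)) :=
  {x | ∀ μ, |x μ 2| ≤ 1 ∧ plSq (x μ) ≤ ((M : ℝ) + 1) ^ 2}

/-- `slabBall M ⊆ slab`. -/
theorem slabBall_subset_slab (M : ℕ) : slabBall M ⊆ slab := fun _ hx μ => (hx μ).1

/-- Auxiliary: `slabBall_mono`. -/
theorem slabBall_mono {M N : ℕ} (h : M ≤ N) : slabBall M ⊆ slabBall N := by
  intro x hx μ
  refine ⟨(hx μ).1, (hx μ).2.trans ?_⟩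
  have : (M : ℝ) ≤ N := by exact_mod_cast h
  nlinarith

/-- Coordinates are continuous on `(ℝ³)³`. -/
theorem continuous_coord (μ : Fin 3) (i : Fin 3) :
    Continuous fun x : Fin 3 → EuclideanSpace ℝ (Fin 3) => x μ i := by
  fun_prop

/-- Auxiliary: `continuous_plSq`. -/
theorem continuous_plSq : Continuous plSq := by unfold plSq; fun_prop

/-- Auxiliary: `continuous_plSum`. -/
theorem continuous_plSum : Continuous plSum := by
  unfold plSum; have := continuous_plSq; fun_prop

/-- Auxiliary: `continuous_crSum`. -/
theorem continuous_crSum : Continuous crSum := by unfold crSum cr; fun_prop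

/-- The slab is measurable (closed). -/
theorem measurableSet_slab : MeasurableSet slab := by
  have : slab = ⋂ μ, {x : Fin 3 → EuclideanSpace ℝ (Fin 3) | |x μ 2| ≤ 1} := by ext x; simp [slab]
  rw [this]
  exact MeasurableSet.iInter fun μ =>
    measurableSet_le ((continuous_coord μ 2).abs).measurable measurable_const

/-- The truncated slab is measurable. -/
theorem measurableSet_slabBall (M : ℕ) : MeasurableSet (slabBall M) := by
  have : slabBall M = ⋂ μ, ({x : Fin 3 → EuclideanSpace ℝ (Fin 3) | |x μ 2| ≤ 1} ∩
      {x | plSq (x μ) ≤ ((M : ℝ) + 1) ^ 2}) := by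
    ext x; simp [slabBall]
  rw [this]
  exact MeasurableSet.iInter fun μ =>
    (measurableSet_le ((continuous_coord μ 2).abs).measurable measurable_const).inter
      (measurableSet_le (continuous_plSq.comp (continuous_apply μ)).measurable measurable_const)

/-- The real kernel `exp(−plSum − crSum)`. -/
def kerR (x : Fin 3 → EuclideanSpace ℝ (Fin 3)) : ℝ := Real.exp (-plSum x - crSum x)

/-- The truncated real kernel `exp(−plSum − crSum − plSum²/(2(M+1)⁴))`. -/
def lamR (M : ℕ) (x : Fin 3 → EuclideanSpace ℝ (Fin 3)) : ℝ :=
  Real.exp (-plSum x - crSum x - plSum x ^ 2 / (2 * ((M : ℝ) + 1) ^ 4))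

/-- Auxiliary: `continuous_kerR`. -/
theorem continuous_kerR : Continuous kerR := by
  unfold kerR; have := continuous_plSum; have := continuous_crSum; fun_prop

/-- Auxiliary: `continuous_lamR`. -/
theorem continuous_lamR (M : ℕ) : Continuous (lamR M) := by
  unfold lamR; have := continuous_plSum; have := continuous_crSum; fun_prop

/-- THE KERNEL `κ = 𝟙_slab · exp(−plSum − crSum)` (β-free). -/
def kappa (x : Fin 3 → EuclideanSpace ℝ (Fin 3)) : ℝ≥0∞ := slab.indicator (fun x => ENNReal.ofReal (kerR x)) x

/-- The truncations `λ_M = 𝟙_{slabBall M} · exp(−plSum − crSum − plSum²/(2(M+1)⁴))`. -/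
def lam (M : ℕ) (x : Fin 3 → EuclideanSpace ℝ (Fin 3)) : ℝ≥0∞ :=
  (slabBall M).indicator (fun x => ENNReal.ofReal (lamR M x)) x

/-- Auxiliary: `measurable_kappa`. -/
theorem measurable_kappa : Measurable kappa :=
  (ENNReal.measurable_ofReal.comp continuous_kerR.measurable).indicator measurableSet_slab

/-- Auxiliary: `measurable_lam`. -/
theorem measurable_lam (M : ℕ) : Measurable (lam M) :=
  (ENNReal.measurable_ofReal.comp (continuous_lamR M).measurable).indicator (measurableSet_slabBall M)

/-- `K = ∫ κ`. -/
def KK : ℝ≥0∞ := ∫⁻ x, kappa x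

/-- `L_M = ∫ λ_M`. -/
def LL (M : ℕ) : ℝ≥0∞ := ∫⁻ x, lam M x

/-- `λ_M ≤ λ_N` for `M ≤ N`. -/
theorem lam_mono {M N : ℕ} (h : M ≤ N) : lam M ≤ lam N := by
  intro x
  unfold lam
  by_cases hx : x ∈ slabBall M
  · rw [indicator_of_mem hx, indicator_of_mem (slabBall_mono h hx)]
    refine ENNReal.ofReal_le_ofReal (Real.exp_le_exp.2 ?_)
    have hM : (0 : ℝ) < ((M : ℝ) + 1) ^ 4 := by positivity
    have hMN : ((M : ℝ) + 1) ^ 4 ≤ ((N : ℝ) + 1) ^ 4 := by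
      have : (M : ℝ) ≤ N := by exact_mod_cast h
      exact pow_le_pow_left₀ (by positivity) (by linarith) 4
    have h1 : plSum x ^ 2 / (2 * ((N : ℝ) + 1) ^ 4) ≤ plSum x ^ 2 / (2 * ((M : ℝ) + 1) ^ 4) :=
      div_le_div_of_nonneg_left (sq_nonneg _) (by positivity) (by linarith)
    linarith
  · rw [indicator_of_notMem hx]; exact zero_le

/-- `λ_M ≤ κ`. -/
theorem lam_le_kappa (M : ℕ) : lam M ≤ kappa := by
  intro x
  unfold lam kappa
  by_cases hx : x ∈ slabBall M
  · rw [indicator_of_mem hx, indicator_of_mem (slabBall_subset_slab M hx)]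
    refine ENNReal.ofReal_le_ofReal (Real.exp_le_exp.2 ?_)
    have : 0 ≤ plSum x ^ 2 / (2 * ((M : ℝ) + 1) ^ 4) := by positivity
    linarith
  · rw [indicator_of_notMem hx]; exact zero_le

/-- Auxiliary: `monotone_lam`. -/
theorem monotone_lam : Monotone lam := fun _ _ h => lam_mono h

/-- Pointwise convergence `λ_M(x) → κ(x)`. -/
theorem tendsto_lam (x : Fin 3 → EuclideanSpace ℝ (Fin 3)) :
    Filter.Tendsto (fun M => lam M x) Filter.atTop (nhds (kappa x)) := by
  by_cases hx : x ∈ slab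
  · -- eventually `x ∈ slabBall M`
    obtain ⟨M₀, hM₀⟩ := exists_nat_ge (plSum x)
    have hev : ∀ M ≥ M₀, x ∈ slabBall M := by
      intro M hM μ
      refine ⟨hx μ, ?_⟩
      have h1 : plSq (x μ) ≤ plSum x := by
        unfold plSum
        exact Finset.single_le_sum (f := fun μ => plSq (x μ)) (fun ν _ => plSq_nonneg _) (Finset.mem_univ μ)
      have h2 : (M₀ : ℝ) ≤ M := by exact_mod_cast hM
      have h3 : plSum x ≤ (M : ℝ) + 1 := by linarith
      have h4 : 0 ≤ plSum x := plSum_nonneg x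
      nlinarith
    have heq : ∀ᶠ M in Filter.atTop, lam M x = ENNReal.ofReal (lamR M x) :=
      Filter.eventually_atTop.2 ⟨M₀, fun M hM => by unfold lam; rw [indicator_of_mem (hev M hM)]⟩
    rw [show kappa x = ENNReal.ofReal (kerR x) by unfold kappa; rw [indicator_of_mem hx]]
    refine Filter.Tendsto.congr' (Filter.EventuallyEq.symm heq) ?_
    refine (ENNReal.continuous_ofReal.tendsto _).comp ?_
    unfold lamR kerR
    refine (Real.continuous_exp.tendsto _).comp ?_
    have h0 : Filter.Tendsto (fun M : ℕ => plSum x ^ 2 / (2 * ((M : ℝ) + 1) ^ 4)) Filter.atTop (nhds 0) := by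
      have h1 : Filter.Tendsto (fun M : ℕ => 2 * ((M : ℝ) + 1) ^ 4) Filter.atTop Filter.atTop := by
        refine Filter.Tendsto.const_mul_atTop (by norm_num) ?_
        refine Filter.tendsto_atTop_atTop.2 fun b => ⟨Nat.ceil |b|, fun M hM => ?_⟩
        have h2 : |b| ≤ M := (Nat.le_ceil |b|).trans (by exact_mod_cast hM)
        have h3 : b ≤ (M : ℝ) + 1 := by linarith [le_abs_self b]
        have h4 : (1 : ℝ) ≤ (M : ℝ) + 1 := by linarith [(Nat.cast_nonneg M : (0:ℝ) ≤ M)]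
        have h5 : (M : ℝ) + 1 ≤ ((M : ℝ) + 1) ^ 4 := by
          calc (M : ℝ) + 1 = ((M : ℝ) + 1) ^ 1 := (pow_one _).symm
            _ ≤ ((M : ℝ) + 1) ^ 4 := pow_le_pow_right₀ h4 (by norm_num)
        linarith
      exact Filter.Tendsto.div_atTop tendsto_const_nhds h1
    have := h0.const_sub (-plSum x - crSum x)
    simpa using this
  · have h0 : ∀ M, lam M x = 0 := fun M => indicator_of_notMem (fun h => hx (slabBall_subset_slab M h)) _
    have hk : kappa x = 0 := indicator_of_notMem hx _
    simp_rw [h0, hk]; exact tendsto_const_nhds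

/-- `⨆_M λ_M = κ` pointwise. -/
theorem iSup_lam (x : Fin 3 → EuclideanSpace ℝ (Fin 3)) : ⨆ M, lam M x = kappa x :=
  tendsto_nhds_unique (tendsto_atTop_iSup fun _ _ h => lam_mono h x) (tendsto_lam x)

/-- MONOTONE CONVERGENCE: `⨆_M L_M = K`. -/
theorem iSup_LL : ⨆ M, LL M = KK := by
  unfold LL KK
  rw [← lintegral_iSup measurable_lam monotone_lam]
  exact lintegral_congr fun x => iSup_lam x

/-- `L_M ≤ K`. -/
theorem LL_le_KK (M : ℕ) : LL M ≤ KK := lintegral_mono (lam_le_kappa M)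

/-- A coordinate is bounded by the norm: `u_i² ≤ ‖u‖²`. -/
theorem sq_coord_le_normSq (u : EuclideanSpace ℝ (Fin 3)) (i : Fin 3) : u i ^ 2 ≤ ‖u‖ ^ 2 := by
  rw [normSq_eq_plSq_add]; unfold plSq
  fin_cases i <;> simp <;> nlinarith [sq_nonneg (u 0), sq_nonneg (u 1), sq_nonneg (u 2)]

/-- `|u_i| ≤ ‖u‖`. -/
theorem abs_coord_le_norm (u : EuclideanSpace ℝ (Fin 3)) (i : Fin 3) : |u i| ≤ ‖u‖ :=
  abs_le_of_sq_le_sq (sq_coord_le_normSq u i) (norm_nonneg _)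

/-- `plSq(u) ≤ ‖u‖²`. -/
theorem plSq_le_normSq (u : EuclideanSpace ℝ (Fin 3)) : plSq u ≤ ‖u‖ ^ 2 := by
  rw [normSq_eq_plSq_add]; nlinarith [sq_nonneg (u 2)]

/-- `K < ∞`: `κ ≤ e³ · Π_μ exp(−‖x_μ‖²/2)`. -/
theorem KK_lt_top : KK < ⊤ := by
  have hbound : ∀ x, kappa x ≤ ENNReal.ofReal (Real.exp 3 * gaussW 3 x) := by
    intro x
    unfold kappa
    by_cases hx : x ∈ slab
    · rw [indicator_of_mem hx]
      refine ENNReal.ofReal_le_ofReal ?_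
      rw [gaussW_eq_exp, ← Real.exp_add]
      refine Real.exp_le_exp.2 ?_
      have hc := crSum_nonneg x
      -- `plSum x = Σ‖x_μ‖² − Σ x_μ2² ≥ Σ‖x_μ‖² − 3`
      have h1 : plSum x ≥ (∑ μ, ‖x μ‖ ^ 2) - 3 := by
        unfold plSum
        have : ∀ μ, plSq (x μ) ≥ ‖x μ‖ ^ 2 - 1 := by
          intro μ
          rw [normSq_eq_plSq_add]
          have := hx μ
          have h2 : x μ 2 ^ 2 ≤ 1 := by
            have := abs_le.1 this; nlinarith
          linarith
        calc ∑ μ, plSq (x μ) ≥ ∑ μ : Fin 3, (‖x μ‖ ^ 2 - 1) := Finset.sum_le_sum fun μ _ => this μ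
          _ = (∑ μ, ‖x μ‖ ^ 2) - 3 := by rw [Finset.sum_sub_distrib]; simp
      have h3 : 0 ≤ ∑ μ, ‖x μ‖ ^ 2 := Finset.sum_nonneg fun μ _ => sq_nonneg _
      rw [neg_div]
      linarith
    · rw [indicator_of_notMem hx]; exact zero_le
  have hint : ∫⁻ x, ENNReal.ofReal (Real.exp 3 * gaussW 3 x) < ⊤ := by
    have hi := (integrable_gaussW 3).const_mul (Real.exp 3)
    exact (hasFiniteIntegral_iff_ofReal (Filter.Eventually.of_forall fun x =>
      mul_nonneg (Real.exp_pos _).le (gaussW_pos 3 x).le)).1 hi.hasFiniteIntegral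
  exact lt_of_le_of_lt (lintegral_mono hbound) hint

/-- Auxiliary: `KK_ne_top`. -/
theorem KK_ne_top : KK ≠ ⊤ := KK_lt_top.ne

/-- `K > 0`: `κ ≥ e^{−8}` on the product of unit balls. -/
theorem KK_pos : 0 < KK := by
  have hS : MeasurableSet (Set.univ.pi fun _ : Fin 3 => Metric.closedBall (0 : EuclideanSpace ℝ (Fin 3)) 1) :=
    MeasurableSet.univ_pi fun _ => Metric.isClosed_closedBall.measurableSet
  have hpos : 0 < volume (Set.univ.pi fun _ : Fin 3 => Metric.closedBall (0 : EuclideanSpace ℝ (Fin 3)) 1) := by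
    rw [volume_pi_pi]
    exact pos_iff_ne_zero.2 (Finset.prod_ne_zero_iff.2 fun μ _ =>
      (Metric.measure_closedBall_pos volume _ zero_lt_one).ne')
  have hle : ∀ x ∈ Set.univ.pi (fun _ : Fin 3 => Metric.closedBall (0 : EuclideanSpace ℝ (Fin 3)) 1),
      ENNReal.ofReal (Real.exp (-8)) ≤ kappa x := by
    intro x hx
    have hn : ∀ μ, ‖x μ‖ ≤ 1 := fun μ => by simpa using hx μ (Set.mem_univ μ)
    have hslab : x ∈ slab := fun μ => (abs_coord_le_norm (x μ) 2).trans (hn μ)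
    unfold kappa; rw [indicator_of_mem hslab]
    refine ENNReal.ofReal_le_ofReal (Real.exp_le_exp.2 ?_)
    have h1 : plSum x ≤ 3 := by
      unfold plSum
      calc ∑ μ, plSq (x μ) ≤ ∑ μ : Fin 3, (1 : ℝ) := Finset.sum_le_sum fun μ _ =>
            (plSq_le_normSq _).trans (by nlinarith [hn μ, norm_nonneg (x μ)])
        _ = 3 := by simp
    have h2 : crSum x ≤ 9 / 2 := by
      unfold crSum
      have : ∀ μ ν, cr (x μ) (x ν) ≤ 1 := by
        intro μ ν
        calc cr (x μ) (x ν) ≤ pd (x μ) (x ν) := cr_le_pd _ _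
          _ ≤ ‖x μ‖ ^ 2 * ‖x ν‖ ^ 2 := by unfold pd; nlinarith [sq_nonneg (inner ℝ (x μ) (x ν))]
          _ ≤ 1 := by
            have := hn μ; have := hn ν
            have a1 : ‖x μ‖ ^ 2 ≤ 1 := by nlinarith [norm_nonneg (x μ)]
            have a2 : ‖x ν‖ ^ 2 ≤ 1 := by nlinarith [norm_nonneg (x ν)]
            nlinarith [sq_nonneg ‖x μ‖, sq_nonneg ‖x ν‖]
      calc (1 / 2 : ℝ) * ∑ μ, ∑ ν, cr (x μ) (x ν) ≤ (1 / 2) * ∑ μ : Fin 3, ∑ ν : Fin 3, (1 : ℝ) := by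
            gcongr with μ _ ν _; exact this μ ν
        _ = 9 / 2 := by simp; norm_num
    linarith
  calc (0 : ℝ≥0∞) < ENNReal.ofReal (Real.exp (-8)) *
        volume (Set.univ.pi fun _ : Fin 3 => Metric.closedBall (0 : EuclideanSpace ℝ (Fin 3)) 1) :=
      ENNReal.mul_pos (ENNReal.ofReal_pos.2 (Real.exp_pos _)).ne' hpos.ne'
    _ = ∫⁻ x in Set.univ.pi (fun _ : Fin 3 => Metric.closedBall (0 : EuclideanSpace ℝ (Fin 3)) 1),
          ENNReal.ofReal (Real.exp (-8)) := by rw [setLIntegral_const]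
    _ ≤ ∫⁻ x in Set.univ.pi (fun _ : Fin 3 => Metric.closedBall (0 : EuclideanSpace ℝ (Fin 3)) 1), kappa x :=
      setLIntegral_mono measurable_kappa hle
    _ ≤ KK := setLIntegral_le_lintegral _ _

/-- Auxiliary: `KK_ne_zero`. -/
theorem KK_ne_zero : KK ≠ 0 := KK_pos.ne'


end Summit.QuantumFields.YangMills.Theorems.ToronValleyVolume.ZeroMode

end
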